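import Summits.HodgeConjecture.HodgeConjecture.Theorems.SixfoldTableXCensusProductRows
import HarnessLib

/-!
# TABLE X (dimension 6) — the Künneth SIXFOLD rows: in the census nodes' domain, satisfying both conclusions, and
# covered by the FLOOR alone (cell `pub-hodgeav-hg6`, req-37 (A) Q2b; eng-4 g3; sequel of `SixfoldTableXCensusProductRows`)

HONEST FRAMING. HC, `HC_AV` (stmt-1333), `HC_CM` (stmt-3052) and the rung H2 are NOT proved and do not occur here. The
census nodes X2 / X1 (`TableX.SixfoldCodimTwoCensus` / `TableX.SixfoldCodimThreeCensus`) are OURS (`@[conjecture]`), never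
asserted; Markman's fourfold theorem enters §2 as a HYPOTHESIS BY NAME (print, preprint-resting). KERNEL ONLY: theorems
over existing declarations; no definition, no `sorry`, no new named fact.

* §1 `sixfoldCensus_of_isIsogenous_prod_of_hasNoTypeIVFactor_of_isOfCMType` (row (a): `B` without type-IV factor and not
  CM, `C` CM, `dim B + dim C = 6`; `…_cm_prod_…`: CM factor first), `sixfoldCensus_of_isIsogenous_fivefold_prod_nonCMCurve` (row (b): fivefold × non-CM
  curve with `End⁰ = ℚ`, `Hom = 0`), `sixfoldCensus_of_isIsogenous_cmFivefold_prod_nonCMCurve` (row (b′): CM fivefold ×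
  such a curve — `Hom = 0` is automatic): each such `A` is a sixfold OFF the residue class `𝒞 = CM ∪ K3P` (spelled exactly
  as in L6 / L7) AND satisfies the X2- and X1-conclusions — UNCONDITIONALLY. With L8 (elliptic-product rows) these are the
  rows of TABLE X on which the two `@[conjecture]` nodes are now theorems of the kernel restricted to the row;
  `exists_cmFivefold_prod_nonCMCurve_census`: a MIXED such row (CM fivefold × non-CM curve) is inhabited — unconditionally.
* §2 `hodgeConjectureFor_of_isIsogenous_prod_of_productSpan_of_markman` and its two instances: on a Künneth sixfold row
  the CONCLUSION of the per-variety theorem L6 (`HodgeConjectureFor A.dim A.X`) follows from the floor `HCUpToDim 5`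
  alone (Moonen–Zarhin + Markman's fourfold theorem, `Ring2.RowFourClosed.hcUpToDim_five_of_markman`; exterior products of
  algebraic classes are algebraic) — none of Markman₆, R-W6, X2, X1 is needed there: the kernel form of TABLE X's verdict
  `floorProduct`. CONDITIONAL on `Markman2025_weilClasses_algebraic_abelianFourfold` only.

Nothing here is a corollary of `HC_CM`; X2 / X1 stay `@[conjecture]` (they quantify over ALL off-residue sixfolds); typed ≠
proved.
-/

set_option linter.dupNamespace false

noncomputable section

open CategoryTheory
open Literature.AlgebraicGeometry Literature.AlgebraicGeometry.Motives
open Literature.AlgebraicGeometry.Motives.AbelianVariety (IsIsogenous IsIsogeny)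
open Literature.AlgebraicGeometry.HodgeTheory
open Literature.AlgebraicGeometry.Milne1999
open Literature.AlgebraicTopology.SingularHomology
open Literature.Barriers.HodgeConjecture
open Summit.HodgeConjecture.HodgeConjecture.Ring2.ClassTargets
open Summit.HodgeConjecture.HodgeConjecture.Ring2.Motiv (ProdCMCell)
open Summit.HodgeConjecture.HodgeConjecture.Ring2.Atlas (IsQuarticFieldTypeIVFourfold)

namespace Summit.HodgeConjecture.HodgeConjecture.TableX.ProductRows

/-! ## §1 The Künneth SIXFOLD rows are in the nodes' domain AND satisfy both conclusions -/

/-- `dim A = 6` for `A ∼ B × C` with `dim B + dim C = 6`. [cite: MumfordAV1970, §4 (products) and §19 Remark p. 169] -/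
theorem dim_eq_six_of_isIsogenous_prod {A B C : AbelianVariety ℂ} (hA : IsIsogenous A (B.prod C))
    (h6 : B.dim + C.dim = 6) : A.dim = 6 := by
  rw [hA.dim_eq, AbelianVariety.dim_prod, h6]

/-- **ROW (a) AT DIMENSION 6, VERIFIED IN THE KERNEL.** Every complex abelian variety `A` isogenous to `B × C` with
`dim B + dim C = 6`, `B` without simple factor of type IV and not of CM type, `C` of CM type (both of positive
dimension) is a SIXFOLD OFF THE RESIDUE CLASS — so X2 / X1 speak about it — and SATISFIES BOTH census conclusions.
Unconditional. [cite: Lombardo2016, Lemma 3.4 (p. 1229)] [cite: MoonenZarhin1999LowDim, §3 (3.1), §5 (5.10)–(5.12)]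
[cite: Milne1999, §2 p. 54] -/
theorem sixfoldCensus_of_isIsogenous_prod_of_hasNoTypeIVFactor_of_isOfCMType {A B C : AbelianVariety ℂ}
    (hB : 0 < B.dim) (hC : 0 < C.dim) (h6 : B.dim + C.dim = 6) (hB4 : HasNoTypeIVFactor B) (hBcm : ¬ IsOfCMType B)
    (hCcm : IsOfCMType C) (hA : IsIsogenous A (B.prod C)) :
    (A.dim = 6 ∧ ¬ (IsOfCMType A ∨ ProdCMCell IsQuarticFieldTypeIVFourfold (fun Z ↦ Z.dim = 2) A)) ∧
    (∀ c : complexBetti A.X (2 * 2), IsRationalClass c → IsOfHodgeType A.dim A.X (2 * 2) 2 2 c →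
      c ∈ divisorClassesSpan A.X A.dim 2 ⊔ Submodule.span ℂ {w' : complexBetti A.X (2 * 2) |
        ∃ (C : AbelianVariety ℂ) (g : A.X ⟶ C.X) (w : complexBetti C.X (2 * 2)), C.dim < A.dim ∧
          IsRationalClass w ∧ IsOfHodgeType C.dim C.X (2 * 2) 2 2 w ∧ w' = complexBetti.map g (2 * 2) w}) ∧
    (∀ c : complexBetti A.X (2 * 3), IsRationalClass c → IsOfHodgeType A.dim A.X (2 * 3) 3 3 c →
      c ∈ divisorClassesSpan A.X A.dim 3 ⊔ Submodule.span ℂ {w' : complexBetti A.X (2 * 3) |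
          ∃ (a : complexBetti A.X (2 * 2)) (b : complexBetti A.X (2 * 1)),
            IsRationalClass a ∧ IsOfHodgeType A.dim A.X (2 * 2) 2 2 a ∧ IsRationalClass b ∧
            IsOfHodgeType A.dim A.X (2 * 1) 1 1 b ∧ w' = cupProduct (two_mul_add_two_mul 2 1) a b} ⊔
        Submodule.span ℂ {w' : complexBetti A.X (2 * 3) |
          ∃ (C : AbelianVariety ℂ) (g : A.X ⟶ C.X) (w : complexBetti C.X (2 * 3)), C.dim < A.dim ∧
            IsRationalClass w ∧ IsOfHodgeType C.dim C.X (2 * 3) 3 3 w ∧ w' = complexBetti.map g (2 * 3) w} ⊔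
        Submodule.span ℂ {w' : complexBetti A.X (2 * 3) |
          ∃ (B' : AbelianVariety ℂ) (g : A.X ⟶ B'.X) (d : ℕ) (ψ : B' ⟶ B') (w : complexBetti B'.X (2 * 3)),
            B'.dim = 6 ∧ 0 < d ∧ ψ ≫ ψ = -(d • 𝟙 B') ∧ IsRationalClass w ∧
            IsOfHodgeType B'.dim B'.X (2 * 3) 3 3 w ∧ w ∈ weilClassesOf B' ψ 3 d ∧
            w' = complexBetti.map g (2 * 3) w}) :=
  ⟨⟨dim_eq_six_of_isIsogenous_prod hA h6,
      not_residueClass_of_isIsogenous_prod_of_hasNoTypeIVFactor_of_isOfCMType hB4 hBcm hCcm hA⟩,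
    census_of_isIsogenous_prod_of_hasNoTypeIVFactor_of_isOfCMType hB hC hB4 hCcm hA⟩

/-- **ROW (a) WITH THE CM FACTOR FIRST** (`A ∼ C × B`, as TABLE X lists `E_k × Y₅`, `S_CM × Y₄`, …): the same
conclusion, through `C × B ∼ B × C` (`isIsogenous_prod_swap`). Unconditional. [cite: Lombardo2016, Lemma 3.4 (p. 1229)]
[cite: MoonenZarhin1999LowDim, §3 (3.1), §5 (5.10)–(5.12)] [cite: Milne1999, §2 p. 54] -/
theorem sixfoldCensus_of_isIsogenous_cm_prod_of_hasNoTypeIVFactor {A B C : AbelianVariety ℂ}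
    (hB : 0 < B.dim) (hC : 0 < C.dim) (h6 : B.dim + C.dim = 6) (hB4 : HasNoTypeIVFactor B) (hBcm : ¬ IsOfCMType B)
    (hCcm : IsOfCMType C) (hA : IsIsogenous A (C.prod B)) :
    (A.dim = 6 ∧ ¬ (IsOfCMType A ∨ ProdCMCell IsQuarticFieldTypeIVFourfold (fun Z ↦ Z.dim = 2) A)) ∧
    (∀ c : complexBetti A.X (2 * 2), IsRationalClass c → IsOfHodgeType A.dim A.X (2 * 2) 2 2 c →
      c ∈ divisorClassesSpan A.X A.dim 2 ⊔ Submodule.span ℂ {w' : complexBetti A.X (2 * 2) |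
        ∃ (C : AbelianVariety ℂ) (g : A.X ⟶ C.X) (w : complexBetti C.X (2 * 2)), C.dim < A.dim ∧
          IsRationalClass w ∧ IsOfHodgeType C.dim C.X (2 * 2) 2 2 w ∧ w' = complexBetti.map g (2 * 2) w}) ∧
    (∀ c : complexBetti A.X (2 * 3), IsRationalClass c → IsOfHodgeType A.dim A.X (2 * 3) 3 3 c →
      c ∈ divisorClassesSpan A.X A.dim 3 ⊔ Submodule.span ℂ {w' : complexBetti A.X (2 * 3) |
          ∃ (a : complexBetti A.X (2 * 2)) (b : complexBetti A.X (2 * 1)),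
            IsRationalClass a ∧ IsOfHodgeType A.dim A.X (2 * 2) 2 2 a ∧ IsRationalClass b ∧
            IsOfHodgeType A.dim A.X (2 * 1) 1 1 b ∧ w' = cupProduct (two_mul_add_two_mul 2 1) a b} ⊔
        Submodule.span ℂ {w' : complexBetti A.X (2 * 3) |
          ∃ (C : AbelianVariety ℂ) (g : A.X ⟶ C.X) (w : complexBetti C.X (2 * 3)), C.dim < A.dim ∧
            IsRationalClass w ∧ IsOfHodgeType C.dim C.X (2 * 3) 3 3 w ∧ w' = complexBetti.map g (2 * 3) w} ⊔
        Submodule.span ℂ {w' : complexBetti A.X (2 * 3) |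
          ∃ (B' : AbelianVariety ℂ) (g : A.X ⟶ B'.X) (d : ℕ) (ψ : B' ⟶ B') (w : complexBetti B'.X (2 * 3)),
            B'.dim = 6 ∧ 0 < d ∧ ψ ≫ ψ = -(d • 𝟙 B') ∧ IsRationalClass w ∧
            IsOfHodgeType B'.dim B'.X (2 * 3) 3 3 w ∧ w ∈ weilClassesOf B' ψ 3 d ∧
            w' = complexBetti.map g (2 * 3) w}) :=
  sixfoldCensus_of_isIsogenous_prod_of_hasNoTypeIVFactor_of_isOfCMType hB hC h6 hB4 hBcm hCcm
    (hA.trans (isIsogenous_prod_swap C B))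

/-- **ROW (b) AT DIMENSION 6, VERIFIED IN THE KERNEL.** Every `A` isogenous to `B × E` with `B` a FIVEFOLD, `E` an
elliptic curve with `End⁰(E) = ℚ` not of CM type and `Hom(B, E) = 0` is a sixfold OFF the residue class that SATISFIES
BOTH census conclusions. Unconditional. [cite: MoonenZarhin1999LowDim, §3 (3.1), Lemma (3.4), Prop. (3.8), §5 (5.10)–(5.12)]
[cite: Milne1999, §2 p. 54] -/
theorem sixfoldCensus_of_isIsogenous_fivefold_prod_nonCMCurve {A B E : AbelianVariety ℂ} (hB5 : B.dim = 5)
    (hE1 : E.dim = 1) (hEend : Module.finrank ℚ E.endAlgebra = 1) (hEcm : ¬ IsOfCMType E)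
    (hBE : ∀ u : B ⟶ E, u = 0) (hA : IsIsogenous A (B.prod E)) :
    (A.dim = 6 ∧ ¬ (IsOfCMType A ∨ ProdCMCell IsQuarticFieldTypeIVFourfold (fun Z ↦ Z.dim = 2) A)) ∧
    (∀ c : complexBetti A.X (2 * 2), IsRationalClass c → IsOfHodgeType A.dim A.X (2 * 2) 2 2 c →
      c ∈ divisorClassesSpan A.X A.dim 2 ⊔ Submodule.span ℂ {w' : complexBetti A.X (2 * 2) |
        ∃ (C : AbelianVariety ℂ) (g : A.X ⟶ C.X) (w : complexBetti C.X (2 * 2)), C.dim < A.dim ∧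
          IsRationalClass w ∧ IsOfHodgeType C.dim C.X (2 * 2) 2 2 w ∧ w' = complexBetti.map g (2 * 2) w}) ∧
    (∀ c : complexBetti A.X (2 * 3), IsRationalClass c → IsOfHodgeType A.dim A.X (2 * 3) 3 3 c →
      c ∈ divisorClassesSpan A.X A.dim 3 ⊔ Submodule.span ℂ {w' : complexBetti A.X (2 * 3) |
          ∃ (a : complexBetti A.X (2 * 2)) (b : complexBetti A.X (2 * 1)),
            IsRationalClass a ∧ IsOfHodgeType A.dim A.X (2 * 2) 2 2 a ∧ IsRationalClass b ∧
            IsOfHodgeType A.dim A.X (2 * 1) 1 1 b ∧ w' = cupProduct (two_mul_add_two_mul 2 1) a b} ⊔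
        Submodule.span ℂ {w' : complexBetti A.X (2 * 3) |
          ∃ (C : AbelianVariety ℂ) (g : A.X ⟶ C.X) (w : complexBetti C.X (2 * 3)), C.dim < A.dim ∧
            IsRationalClass w ∧ IsOfHodgeType C.dim C.X (2 * 3) 3 3 w ∧ w' = complexBetti.map g (2 * 3) w} ⊔
        Submodule.span ℂ {w' : complexBetti A.X (2 * 3) |
          ∃ (B' : AbelianVariety ℂ) (g : A.X ⟶ B'.X) (d : ℕ) (ψ : B' ⟶ B') (w : complexBetti B'.X (2 * 3)),
            B'.dim = 6 ∧ 0 < d ∧ ψ ≫ ψ = -(d • 𝟙 B') ∧ IsRationalClass w ∧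
            IsOfHodgeType B'.dim B'.X (2 * 3) 3 3 w ∧ w ∈ weilClassesOf B' ψ 3 d ∧
            w' = complexBetti.map g (2 * 3) w}) :=
  ⟨⟨dim_eq_six_of_isIsogenous_prod hA (by omega), not_residueClass_of_isIsogenous_prod_nonCMCurve hE1 hEcm hA⟩,
    census_of_isIsogenous_prod_nonCMCurve (by omega) hE1 hEend hBE hA⟩

/-- **ROW (b′): a CM FIVEFOLD times an elliptic curve with `End⁰ = ℚ`.** Here `Hom(B, E) = 0` is automatic (no non-zero
homomorphism from a CM variety to a non-CM curve, Milne 1999 §2 / Shimura §5.1), so EVERY `A ∼ B × E` with `B` of CM type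
of dimension `5` and `E` a non-CM curve with `End⁰(E) = ℚ` is an off-residue sixfold satisfying X2 and X1 — TABLE X's rows
«CM fivefold × generic curve». Unconditional. [cite: MoonenZarhin1999LowDim, §3 Prop. (3.8), §5 (5.10)–(5.12)]
[cite: Milne1999, §2 p. 54] [cite: Shimura1998, §5.1 Propositions 3, 4, 6] -/
theorem sixfoldCensus_of_isIsogenous_cmFivefold_prod_nonCMCurve {A B E : AbelianVariety ℂ} (hB5 : B.dim = 5)
    (hBcm : IsOfCMType B) (hE1 : E.dim = 1) (hEend : Module.finrank ℚ E.endAlgebra = 1) (hEcm : ¬ IsOfCMType E)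
    (hA : IsIsogenous A (B.prod E)) :
    (A.dim = 6 ∧ ¬ (IsOfCMType A ∨ ProdCMCell IsQuarticFieldTypeIVFourfold (fun Z ↦ Z.dim = 2) A)) ∧
    (∀ c : complexBetti A.X (2 * 2), IsRationalClass c → IsOfHodgeType A.dim A.X (2 * 2) 2 2 c →
      c ∈ divisorClassesSpan A.X A.dim 2 ⊔ Submodule.span ℂ {w' : complexBetti A.X (2 * 2) |
        ∃ (C : AbelianVariety ℂ) (g : A.X ⟶ C.X) (w : complexBetti C.X (2 * 2)), C.dim < A.dim ∧
          IsRationalClass w ∧ IsOfHodgeType C.dim C.X (2 * 2) 2 2 w ∧ w' = complexBetti.map g (2 * 2) w}) ∧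
    (∀ c : complexBetti A.X (2 * 3), IsRationalClass c → IsOfHodgeType A.dim A.X (2 * 3) 3 3 c →
      c ∈ divisorClassesSpan A.X A.dim 3 ⊔ Submodule.span ℂ {w' : complexBetti A.X (2 * 3) |
          ∃ (a : complexBetti A.X (2 * 2)) (b : complexBetti A.X (2 * 1)),
            IsRationalClass a ∧ IsOfHodgeType A.dim A.X (2 * 2) 2 2 a ∧ IsRationalClass b ∧
            IsOfHodgeType A.dim A.X (2 * 1) 1 1 b ∧ w' = cupProduct (two_mul_add_two_mul 2 1) a b} ⊔
        Submodule.span ℂ {w' : complexBetti A.X (2 * 3) |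
          ∃ (C : AbelianVariety ℂ) (g : A.X ⟶ C.X) (w : complexBetti C.X (2 * 3)), C.dim < A.dim ∧
            IsRationalClass w ∧ IsOfHodgeType C.dim C.X (2 * 3) 3 3 w ∧ w' = complexBetti.map g (2 * 3) w} ⊔
        Submodule.span ℂ {w' : complexBetti A.X (2 * 3) |
          ∃ (B' : AbelianVariety ℂ) (g : A.X ⟶ B'.X) (d : ℕ) (ψ : B' ⟶ B') (w : complexBetti B'.X (2 * 3)),
            B'.dim = 6 ∧ 0 < d ∧ ψ ≫ ψ = -(d • 𝟙 B') ∧ IsRationalClass w ∧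
            IsOfHodgeType B'.dim B'.X (2 * 3) 3 3 w ∧ w ∈ weilClassesOf B' ψ 3 d ∧
            w' = complexBetti.map g (2 * 3) w}) :=
  sixfoldCensus_of_isIsogenous_fivefold_prod_nonCMCurve hB5 hE1 hEend hEcm
    (fun u ↦ hom_eq_zero_of_isOfCMType_of_not_isOfCMType_of_dim_eq_one hBcm hE1 hEcm u) hA

/-- **A MIXED Künneth sixfold row is INHABITED and VERIFIED, unconditionally.** There are a CM fivefold `B` (the tree's
realisation record `ComplexMultiplication.exists_isOfCMType_dim_eq_succ`, Shimura 1998 §6.2 Thm. 3) and an elliptic curve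
`E` with `End⁰(E) = ℚ`, not of CM type (`NonCMCurve.exists_ellipticCurve_not_isOfCMType`, Riemann's theorem at the period
`√2 + i`), and `A = B × E` is a sixfold OFF the residue class satisfying BOTH census conclusions — an inhabitant of the
nodes' domain of a kind different from L7 / L8's `E × E⁵` (it has a CM factor; it is not an elliptic-product row).
[cite: Shimura1998, §6.2 Theorem 3 (pp. 41–42)] [cite: MoonenZarhin1999LowDim, §3 Prop. (3.8), §5 (5.10)–(5.12)]
[cite: Milne1999, §2 p. 54] -/
theorem exists_cmFivefold_prod_nonCMCurve_census :
    ∃ A : AbelianVariety ℂ,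
      (∃ B E : AbelianVariety ℂ, IsOfCMType B ∧ B.dim = 5 ∧ E.dim = 1 ∧ ¬ IsOfCMType E ∧ A = B.prod E) ∧
      (A.dim = 6 ∧ ¬ (IsOfCMType A ∨ ProdCMCell IsQuarticFieldTypeIVFourfold (fun Z ↦ Z.dim = 2) A)) ∧
      (∀ c : complexBetti A.X (2 * 2), IsRationalClass c → IsOfHodgeType A.dim A.X (2 * 2) 2 2 c →
        c ∈ divisorClassesSpan A.X A.dim 2 ⊔ Submodule.span ℂ {w' : complexBetti A.X (2 * 2) |
          ∃ (C : AbelianVariety ℂ) (g : A.X ⟶ C.X) (w : complexBetti C.X (2 * 2)), C.dim < A.dim ∧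
            IsRationalClass w ∧ IsOfHodgeType C.dim C.X (2 * 2) 2 2 w ∧ w' = complexBetti.map g (2 * 2) w}) ∧
      (∀ c : complexBetti A.X (2 * 3), IsRationalClass c → IsOfHodgeType A.dim A.X (2 * 3) 3 3 c →
        c ∈ divisorClassesSpan A.X A.dim 3 ⊔ Submodule.span ℂ {w' : complexBetti A.X (2 * 3) |
            ∃ (a : complexBetti A.X (2 * 2)) (b : complexBetti A.X (2 * 1)),
              IsRationalClass a ∧ IsOfHodgeType A.dim A.X (2 * 2) 2 2 a ∧ IsRationalClass b ∧
              IsOfHodgeType A.dim A.X (2 * 1) 1 1 b ∧ w' = cupProduct (two_mul_add_two_mul 2 1) a b} ⊔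
          Submodule.span ℂ {w' : complexBetti A.X (2 * 3) |
            ∃ (C : AbelianVariety ℂ) (g : A.X ⟶ C.X) (w : complexBetti C.X (2 * 3)), C.dim < A.dim ∧
              IsRationalClass w ∧ IsOfHodgeType C.dim C.X (2 * 3) 3 3 w ∧ w' = complexBetti.map g (2 * 3) w} ⊔
          Submodule.span ℂ {w' : complexBetti A.X (2 * 3) |
            ∃ (B' : AbelianVariety ℂ) (g : A.X ⟶ B'.X) (d : ℕ) (ψ : B' ⟶ B') (w : complexBetti B'.X (2 * 3)),
              B'.dim = 6 ∧ 0 < d ∧ ψ ≫ ψ = -(d • 𝟙 B') ∧ IsRationalClass w ∧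
              IsOfHodgeType B'.dim B'.X (2 * 3) 3 3 w ∧ w ∈ weilClassesOf B' ψ 3 d ∧
              w' = complexBetti.map g (2 * 3) w}) := by
  obtain ⟨B, -, hBcm, hB5⟩ := ComplexMultiplication.exists_isOfCMType_dim_eq_succ 4
  obtain ⟨E, hE1, -, hEend, hEcm⟩ := NonCMCurve.exists_ellipticCurve_not_isOfCMType
  exact ⟨B.prod E, ⟨B, E, hBcm, hB5, hE1, hEcm, rfl⟩,
    sixfoldCensus_of_isIsogenous_cmFivefold_prod_nonCMCurve hB5 hBcm hE1 hEend hEcm (AbelianVariety.IsIsogenous.refl _)⟩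

/-! ## §2 On the Künneth rows the per-variety theorem L6 needs only the FLOOR (TABLE X verdict `floorProduct`) -/

/-- **HC on a Künneth sixfold row from Markman's FOURFOLD theorem alone.** For `A ∼ B × C` with `dim B + dim C = 6`,
both factors of positive dimension and `HodgeClassesProductSpan B C`, the conclusion of the per-variety theorem L6
(`HodgeConjectureFor A.dim A.X`) follows from HC for `B` and for `C` (both of dimension `≤ 5`: the floor `HCUpToDim 5`,
Moonen–Zarhin + Markman's fourfold theorem, `Ring2.RowFourClosed.hcUpToDim_five_of_markman`) — none of Markman₆, R-W6,
X2, X1 is needed on these rows; this is the kernel form of TABLE X's verdict `floorProduct`. CONDITIONAL on the named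
print fact `Markman2025_weilClasses_algebraic_abelianFourfold` only. [claim: Markman2025SurveySecant, status: under-review]
[cite: Markman2025SecantWeil, Thm. 1.5.1 and Cor. 1.6.1] [cite: MoonenZarhin1999LowDim, Thms. 0.1–0.2 and §3 (3.1)] -/
theorem hodgeConjectureFor_of_isIsogenous_prod_of_productSpan_of_markman
    (hMark : Markman2025_weilClasses_algebraic_abelianFourfold) {A B C : AbelianVariety ℂ} (hB : 0 < B.dim)
    (hC : 0 < C.dim) (h6 : B.dim + C.dim = 6) (hS : HodgeClassesProductSpan B C) (hA : IsIsogenous A (B.prod C)) :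
    HodgeConjectureFor A.dim A.X :=
  HodgeConjectureFor.of_isIsogenous hA (hodgeConjectureFor_prod_of_productSpan B C hS
    (Ring2.RowFourClosed.hcUpToDim_five_of_markman hMark B (by omega))
    (Ring2.RowFourClosed.hcUpToDim_five_of_markman hMark C (by omega)))

/-- **Row (a) from the floor alone** (`B` no type-IV factor, `C` of CM type). [cite: Lombardo2016, Lemma 3.4 (p. 1229)]
[cite: Markman2025SecantWeil, Cor. 1.6.1] [claim: Markman2025SurveySecant, status: under-review] -/
theorem hodgeConjectureFor_of_isIsogenous_prod_of_hasNoTypeIVFactor_of_isOfCMType_of_markman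
    (hMark : Markman2025_weilClasses_algebraic_abelianFourfold) {A B C : AbelianVariety ℂ} (hB : 0 < B.dim)
    (hC : 0 < C.dim) (h6 : B.dim + C.dim = 6) (hB4 : HasNoTypeIVFactor B) (hCcm : IsOfCMType C)
    (hA : IsIsogenous A (B.prod C)) : HodgeConjectureFor A.dim A.X :=
  hodgeConjectureFor_of_isIsogenous_prod_of_productSpan_of_markman hMark hB hC h6
    (Lombardo2016_hodgeClassesProductSpan_holds B C hB4 hCcm) hA

/-- **Row (b) from the floor alone** (fivefold × non-CM curve with `Hom = 0`). [cite: MoonenZarhin1999LowDim, Prop. (3.8)]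
[cite: Markman2025SecantWeil, Cor. 1.6.1] [claim: Markman2025SurveySecant, status: under-review] -/
theorem hodgeConjectureFor_of_isIsogenous_fivefold_prod_nonCMCurve_of_markman
    (hMark : Markman2025_weilClasses_algebraic_abelianFourfold) {A B E : AbelianVariety ℂ} (hB5 : B.dim = 5)
    (hE1 : E.dim = 1) (hEend : Module.finrank ℚ E.endAlgebra = 1) (hBE : ∀ u : B ⟶ E, u = 0)
    (hA : IsIsogenous A (B.prod E)) : HodgeConjectureFor A.dim A.X :=
  hodgeConjectureFor_of_isIsogenous_prod_of_productSpan_of_markman hMark (by omega) (by omega) (by omega)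
    (hodgeClassesProductSpan_of_nonCMCurve_of_forall_hom_eq_zero hE1 hEend hBE) hA

end Summit.HodgeConjecture.HodgeConjecture.TableX.ProductRows
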